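import Literature.AlgebraicGeometry.Resolution.LocalBlowup
import HarnessLib

/-!
# The centre of a monomial chart over a local ring with monomially generated maximal ideal

Topic: `Literature/AlgebraicGeometry/Resolution`. PROOF side of `CossartPiltant2019ReductionP`
(`ArithmeticalThreefoldsLocal.lean`), seventh brick of its one remaining input (C4) — descent of
local uniformization below the ramification field ([CoP1] Props. 9.3/9.5 with Lemma 9.4). In the
proof of [CoP1] Lemma 9.4 (HAL p. 29), after the diagonalisation (29)–(30) the old parameters
become monomials in new elements `y₁, y₂, y₃` of non-negative value ((53): "`yᵢ := ∏ⱼ xⱼ^{vᵢⱼ}`",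
with (b) "`ℕ³ ⊆ ℕv₁ + ℕv₂ + ℕv₃`" and (c) "`∑ⱼ vᵢⱼ W(xⱼ) ≥ 0`"), and "`S̄ := S[y₁, y₂, y₃]` … By (c),
`S₁ := S̄_{𝔪_W ∩ S̄}` is a local model of `W` and `S₁` is regular by (b)". The ideal-theoretic
content of "regular by (b)" — and equally of the regularity of a toric chart over the ring of
invariants, whose maximal ideal is generated by invariant monomials
(`TameCyclicMonomialStructure.lean`) — is the following statement, proved here in the tree's
currency (`locAtCentre`, `LocalBlowup.lean`), in the case where the new elements all have
POSITIVE value: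

* `exists_sum_mul_of_mem_locAtCentre_adjoin_monomials` — PROVED: let `A ⊆ O` be a local subring of
  a field `E` dominated by the valuation ring `O`, whose maximal ideal is generated by elements
  each of which is a monomial `∏ yᵢ^{cᵢ}` (`c ≠ 0`) in finitely many `y₁, …, y_d ∈ O` of positive
  value; then every element of positive value of the local ring `T_{𝔪_O ∩ T}`,
  `T := A[y₁, …, y_d]`, is `∑ rᵢ yᵢ` with `rᵢ ∈ T_{𝔪_O ∩ T}` — i.e. the maximal ideal of the chart
  is generated by `y₁, …, y_d` (so the chart is regular as soon as its dimension is `d`,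
  `LocalModels.ringKrullDim_localization_centre_eq`).

Everything is PROVED; no named facts are introduced.

## Sources

* V. Cossart, O. Piltant, *Resolution of singularities of threefolds in positive characteristic.
  I*, J. Algebra 320 (2008) 1051–1082: proof of Lemma 9.4, (53)–(54) (HAL hal-00139124, p. 29).
  [CossartPiltant2008]
-/

noncomputable section

namespace Literature.AlgebraicGeometry.Resolution

universe u

section Chart

variable {E : Type u} [Field E] (O : ValuationSubring E)

/-- Elements of `A[y₁, …, y_d]` (the subring generated by `A` and the `yᵢ`) are `a + ∑ rᵢ yᵢ` with
`a ∈ A` and `rᵢ ∈ A[y]`. [folklore] -/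
private theorem exists_add_sum_of_mem_closure (A : Subring E) {d : ℕ} (y : Fin d → E) {f : E}
    (hf : f ∈ Subring.closure ((A : Set E) ∪ Set.range y)) :
    ∃ a ∈ A, ∃ r : Fin d → E, (∀ i, r i ∈ Subring.closure ((A : Set E) ∪ Set.range y)) ∧
      f = a + ∑ i, r i * y i := by
  classical
  set T := Subring.closure ((A : Set E) ∪ Set.range y) with hT
  induction hf using Subring.closure_induction with
  | mem x hx =>
    rcases hx with hxA | ⟨i, rfl⟩
    · exact ⟨x, hxA, 0, fun _ => T.zero_mem, by simp⟩
    · refine ⟨0, A.zero_mem, Pi.single i 1, fun j => ?_, ?_⟩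
      · by_cases h : j = i
        · subst h; simp only [Pi.single_eq_same]; exact T.one_mem
        · rw [Pi.single_eq_of_ne h]; exact T.zero_mem
      · rw [zero_add, Finset.sum_eq_single i (fun j _ hj => by rw [Pi.single_eq_of_ne hj, zero_mul])
          (fun h => absurd (Finset.mem_univ i) h), Pi.single_eq_same, one_mul]
  | zero => exact ⟨0, A.zero_mem, 0, fun _ => T.zero_mem, by simp⟩
  | one => exact ⟨1, A.one_mem, 0, fun _ => T.zero_mem, by simp⟩
  | add f g hf hg ihf ihg =>
    obtain ⟨a, ha, r, hr, rfl⟩ := ihf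
    obtain ⟨b, hb, s, hs, rfl⟩ := ihg
    refine ⟨a + b, A.add_mem ha hb, r + s, fun i => T.add_mem (hr i) (hs i), ?_⟩
    simp only [Pi.add_apply, add_mul, Finset.sum_add_distrib]
    ring
  | neg f hf ihf =>
    obtain ⟨a, ha, r, hr, rfl⟩ := ihf
    refine ⟨-a, A.neg_mem ha, -r, fun i => T.neg_mem (hr i), ?_⟩
    simp only [Pi.neg_apply, neg_mul, Finset.sum_neg_distrib]
    ring
  | mul f g hf hg ihf ihg =>
    obtain ⟨a, ha, r, hr, rfl⟩ := ihf
    obtain ⟨b, hb, s, hs, hgeq⟩ := ihg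
    -- `(a + ∑ rᵢ yᵢ) g = a b + ∑ (a sᵢ + rᵢ g) yᵢ`
    have haT : a ∈ T := Subring.subset_closure (Set.mem_union_left _ ha)
    refine ⟨a * b, A.mul_mem ha hb, fun i => a * s i + r i * g,
      fun i => T.add_mem (T.mul_mem haT (hs i)) (T.mul_mem (hr i) hg), ?_⟩
    calc (a + ∑ i, r i * y i) * g
        = a * g + ∑ i, r i * g * y i := by
          rw [add_mul, Finset.sum_mul]
          congr 1
          exact Finset.sum_congr rfl fun i _ => by ring
      _ = a * (b + ∑ i, s i * y i) + ∑ i, r i * g * y i := by rw [← hgeq]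
      _ = a * b + ∑ i, (a * s i + r i * g) * y i := by
          rw [mul_add, Finset.mul_sum, add_assoc, ← Finset.sum_add_distrib]
          congr 1
          exact Finset.sum_congr rfl fun i _ => by ring

/-- **The centre of a monomial chart is generated by the new monomial parameters** ([CoP1] proof
of Lemma 9.4, (53)–(54): "`S̄ := S[y₁, y₂, y₃]` … `S₁ := S̄_{𝔪_W ∩ S̄}` is a local model of `W` and
`S₁` is regular by (b)", HAL p. 29 — the old parameters being monomials in the `yᵢ` by (b); the
same statement serves the toric chart over the ring of invariants, whose maximal ideal is
generated by invariant monomials). Let `O` be a valuation ring of a field `E`, `A ⊆ O` a subring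
which is a local ring dominated by `O` (`a ∈ 𝔪_A ↔ v(a) > 0`), `y₁, …, y_d ∈ O` of POSITIVE value,
and suppose `𝔪_A` is generated by a set `G` of elements each of which is a monomial `∏ᵢ yᵢ^{cᵢ}`
with `c ≠ 0`. Then every element of positive value of `T_{𝔪_O ∩ T}`, `T := A[y₁, …, y_d]`, is
`∑ᵢ rᵢ yᵢ` with `rᵢ ∈ T_{𝔪_O ∩ T}`: the maximal ideal of the chart is `(y₁, …, y_d)`. Proof: an
element of `T` is `a + ∑ rᵢ yᵢ` (`a ∈ A`, `rᵢ ∈ T`); if its value is positive, so is that of `a`,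
hence `a ∈ 𝔪_A = (G)` and each `g ∈ G` is `y_{i₀} · (monomial) ∈ ∑ yᵢ T`.
[cite: CossartPiltant2008, proof of Lemma 9.4, (53)–(54) and "S₁ is regular by (b)" (HAL p. 29)] -/
theorem exists_sum_mul_of_mem_locAtCentre_adjoin_monomials (A : Subring E) [IsLocalRing A]
    (hAO : A ≤ O.toSubring)
    (hdom : ∀ a : A, a ∈ IsLocalRing.maximalIdeal A ↔ O.valuation (a : E) < 1)
    {d : ℕ} (y : Fin d → E) (hyO : ∀ i, y i ∈ O) (hypos : ∀ i, O.valuation (y i) < 1)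
    (G : Set A) (hG : Ideal.span G = IsLocalRing.maximalIdeal A)
    (hGmon : ∀ g ∈ G, ∃ c : Fin d → ℕ, c ≠ 0 ∧ ((g : A) : E) = ∏ i, y i ^ c i)
    {z : E} (hz : z ∈ locAtCentre (Subring.closure ((A : Set E) ∪ Set.range y)) O)
    (hzv : O.valuation z < 1) :
    ∃ r : Fin d → E, (∀ i, r i ∈ locAtCentre (Subring.closure ((A : Set E) ∪ Set.range y)) O) ∧
      z = ∑ i, r i * y i := by
  classical
  set T := Subring.closure ((A : Set E) ∪ Set.range y) with hT
  have hTO : T ≤ O.toSubring := Subring.closure_le.mpr (Set.union_subset hAO (by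
    rintro _ ⟨i, rfl⟩; exact hyO i))
  have hyT : ∀ i, y i ∈ T := fun i => Subring.subset_closure (Set.mem_union_right _ ⟨i, rfl⟩)
  have hAT : ∀ a ∈ A, a ∈ T := fun a ha => Subring.subset_closure (Set.mem_union_left _ ha)
  -- Step 1: every element of `T` of positive value lies in `∑ yᵢ T`
  have hstep : ∀ f ∈ T, O.valuation f < 1 → ∃ q : Fin d → E, (∀ i, q i ∈ T) ∧ f = ∑ i, q i * y i := by
    intro f hf hfv
    obtain ⟨a, ha, r, hr, hfeq⟩ := exists_add_sum_of_mem_closure A y hf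
    -- the tail has positive value, hence so has `a`
    have hvalT : ∀ t ∈ T, O.valuation t ≤ 1 := fun t ht => (O.valuation_le_one_iff t).mpr (hTO ht)
    have htail : O.valuation (∑ i, r i * y i) < 1 := by
      refine O.valuation.map_sum_lt one_ne_zero fun i _ => ?_
      rw [map_mul]
      exact lt_of_le_of_lt (mul_le_of_le_one_left' (hvalT _ (hr i))) (hypos i)
    have hav : O.valuation a < 1 := by
      have : a = f - ∑ i, r i * y i := by rw [hfeq]; ring
      rw [this]
      exact O.valuation.map_sub_lt hfv htail
    -- so `a ∈ 𝔪_A = (G)`, a combination of monomials, each divisible by some `yᵢ` in `T`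
    have ham : (⟨a, ha⟩ : A) ∈ IsLocalRing.maximalIdeal A := (hdom ⟨a, ha⟩).mpr hav
    rw [← hG] at ham
    have haY : ∃ q : Fin d → E, (∀ i, q i ∈ T) ∧ a = ∑ i, q i * y i := by
      refine Submodule.span_induction (p := fun b _ => ∃ q : Fin d → E, (∀ i, q i ∈ T) ∧
          ((b : A) : E) = ∑ i, q i * y i) ?_ ?_ ?_ ?_ ham
      · intro g hg
        obtain ⟨c, hc0, hgc⟩ := hGmon g hg
        obtain ⟨i₀, hi₀⟩ : ∃ i, c i ≠ 0 := by
          by_contra h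
          exact hc0 (funext fun i => not_ne_iff.mp (not_exists.mp h i))
        -- `g = y_{i₀} · (y_{i₀}^{c_{i₀} - 1} ∏_{i ≠ i₀} yᵢ^{cᵢ})`
        set m : E := y i₀ ^ (c i₀ - 1) * ∏ i ∈ Finset.univ.erase i₀, y i ^ c i with hm
        have hmT : m ∈ T := T.mul_mem (T.pow_mem (hyT i₀) _)
          (T.prod_mem fun i _ => T.pow_mem (hyT i) _)
        have hgm : ((g : A) : E) = m * y i₀ := by
          rw [hgc, ← Finset.mul_prod_erase Finset.univ (fun i => y i ^ c i) (Finset.mem_univ i₀), hm]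
          have : y i₀ ^ c i₀ = y i₀ ^ (c i₀ - 1) * y i₀ := by
            rw [← pow_succ, Nat.sub_add_cancel (Nat.pos_of_ne_zero hi₀)]
          rw [this]; ring
        refine ⟨Pi.single i₀ m, fun i => ?_, ?_⟩
        · by_cases h : i = i₀
          · subst h; simp only [Pi.single_eq_same]; exact hmT
          · rw [Pi.single_eq_of_ne h]; exact T.zero_mem
        · rw [hgm, Finset.sum_eq_single i₀ (fun j _ hj => by rw [Pi.single_eq_of_ne hj, zero_mul])
            (fun h => absurd (Finset.mem_univ i₀) h), Pi.single_eq_same]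
      · exact ⟨0, fun _ => T.zero_mem, by simp⟩
      · rintro b₁ b₂ - - ⟨q₁, hq₁, h₁⟩ ⟨q₂, hq₂, h₂⟩
        refine ⟨q₁ + q₂, fun i => T.add_mem (hq₁ i) (hq₂ i), ?_⟩
        rw [Subring.coe_add, h₁, h₂, ← Finset.sum_add_distrib]
        exact Finset.sum_congr rfl fun i _ => by rw [Pi.add_apply, add_mul]
      · rintro w b - ⟨q, hq, hb⟩
        refine ⟨fun i => (w : E) * q i, fun i => T.mul_mem (hAT _ w.2) (hq i), ?_⟩
        rw [smul_eq_mul, Subring.coe_mul, hb, Finset.mul_sum]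
        exact Finset.sum_congr rfl fun i _ => by ring
    obtain ⟨q, hq, haq⟩ := haY
    refine ⟨q + r, fun i => T.add_mem (hq i) (hr i), ?_⟩
    rw [hfeq, haq, ← Finset.sum_add_distrib]
    exact Finset.sum_congr rfl fun i _ => by rw [Pi.add_apply, add_mul]
  -- Step 2: pass to the local ring `T_{𝔪_O ∩ T}`
  obtain ⟨f, hf, g, hg, hgv, rfl⟩ := mem_locAtCentre_iff.mp hz
  have hg0 : g ≠ 0 := ne_zero_of_valuation_eq_one hgv
  have hfv : O.valuation f < 1 := by
    have h := map_mul O.valuation (f / g) g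
    rw [div_mul_cancel₀ f hg0, hgv, mul_one] at h
    rw [h]; exact hzv
  obtain ⟨q, hq, hfq⟩ := hstep f hf hfv
  refine ⟨fun i => q i / g, fun i => mem_locAtCentre_iff.mpr ⟨q i, hq i, g, hg, hgv, rfl⟩, ?_⟩
  rw [hfq, div_eq_mul_inv, Finset.sum_mul]
  exact Finset.sum_congr rfl fun i _ => by ring

end Chart

end Literature.AlgebraicGeometry.Resolution

end
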